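import Summits.NavierStokesRegularity.NavierStokesRegularity.Theorems.PerpetualPumpPumpTransferMildOfBandField
import Literature.Analysis.FluidPDE.TaoCascadeModeDuhamel

/-!
# Crux `PerpetualPump.AveragedTypeIBlowup` (stmt-NavierStokesRegularity-1835), line `Sketch`:
# tools for the stub `synthMild` (the wavelet Duhamel series of a chain solution is a mild solution)

T. Tao, *Finite time blowup for an averaged three-dimensional Navier–Stokes equation*, J. Amer.
Math. Soc. **29** (2016), 601–674 = arXiv:1402.0290v3, §4, proof of Lemma 4.1, p. 22, (4.14)–(4.15).

Helper file (theorems only) for the registered stub `stub_synthMild` of the lead's skeleton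
`Cruxes/AveragedTypeIBlowup/Lines/Sketch.lean`. The stub is handed a field `u` on `[0,S)` whose pairings
expand as the wavelet Duhamel series of a solution `Y` of the exact Volterra chain,
`⟨u(t), w⟩ - ⟨e^{tΔ}(Aψ_{i₀,n₀}), w⟩ = Σ_{(i,n)} ∫₀ᵗ quadTerm(Y)_{i,n}(s) ⟨e^{(t-s)Δ}ψ_{i,n}, w⟩ ds`, and must
show that `u` is a mild solution of the cascade equation (3.3)/(4.1) with coefficients `Y`. The tools:

* `pairing_heat_cascadeWavelet_of_ne`, `pairing_heat_cascadeWavelet_self_eq_ofReal` — the heat flow keeps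
  the wavelets `ψ_{i,n}` Fourier-disjoint (so testing the series with `ψ_{j,k}` collapses it) and
  `⟨e^{τΔ}ψ_{i,n}, ψ_{i,n}⟩` is real; the first is also recorded in closed form as the registered
  sub-goal `stub_synthMildHeatOrthogonal` of the crux item (the handle under which this helper file lands);
* `weighted_abs_le_of_decay` — the chain's decay `(1+ε₀)^{20k}|Y_{j,k}| ≤ C` with no modes below `n₀`
  gives the weighted bound `(1+(1+ε₀)^{10k})|Y_{j,k}| ≤ C'` used by the sibling route item `PumpTransfer`;
* `abs_quadTerm_le_of_le_one`, `cascadeOperatorForm_eq_tsum_quadTerm_of_le_one` — the bound (4.8) on the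
  circuit nonlinearity and the regrouping of `⟨C(f,f), g⟩` by output mode,
  `⟨C(f,f), g⟩ = Σ_{(i,n)} quadTerm_{i,n}(X) ⟨g, ψ_{i,n}⟩`, for `0 < ε₀ ≤ 1` (the landed
  `PerpetualPumpPumpTransfer.abs_quadTerm_le` / `cascadeOperatorForm_eq_tsum_quadTerm` assume `ε₀ < 1`;
  the proofs are theirs verbatim, only `1+ε₀ ≤ 2` is used);
* `hasSum_integral_duhamelTerms_of_continuousOn` — the exchange of `Σ_{(i,n)}` and `∫₀ᵗ` for forcings
  that are only continuous on `[0,t]` (the landed `hasSum_integral_duhamelTerms` asks for global continuity).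

Nothing here closes the item (`--supports`); no statement of the route changes.

## References

* T. Tao, J. Amer. Math. Soc. 29 (2016), 601–674, arXiv:1402.0290v3, §4 Lemma 4.1, p. 22
  ((4.8), (4.14), (4.15)). [`Tao2016AveragedNS`]
-/

noncomputable section

-- the summit namespace `…NavierStokesRegularity.NavierStokesRegularity…` is the tree convention
set_option linter.dupNamespace false

open MeasureTheory Set Filter Topology
open scoped ENNReal
open Literature.Analysis.FluidPDE Literature.Analysis.FluidPDE.Tao2016
open Literature.Analysis.FluidPDE.TaoCascade (quadTerm IsSymmetricCoeff IsCancellingCoeff)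
-- reindexing and summability tools of the sibling route item `PumpTransfer` (Lemma 4.1, synthesis direction)
open Summit.NavierStokesRegularity.NavierStokesRegularity.Theorems.PerpetualPumpPumpTransfer
  (cascadeSum_eq_tsum summable_fibreBound single_le_sum₃ weight_shift_le rpow_five_halves_le)
-- the heat propagator on `L²`: strong continuity and contraction (route item `EulerTypeIGlue`)
open Summit.NavierStokesRegularity.NavierStokesRegularity.Theorems.PerpetualPumpEulerTypeIGlue
  (continuous_heat_apply norm_heat_le)

namespace Summit.NavierStokesRegularity.NavierStokesRegularity.Theorems.PerpetualPumpAveragedTypeIBlowup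

variable {ε₀ : ℝ} {m : ℕ}

/-! ### The heat flow on the wavelets: disjointness and realness -/

/-- **The heat flow keeps distinct wavelets orthogonal**: `⟨e^{τΔ}ψ_{i,n}, ψ_{j,k}⟩ = 0` for
`(i,n) ≠ (j,k)` (`e^{τΔ}ψ_{i,n}` is still band-limited to the region of `(i,n)`, which misses the
Fourier support of every other wavelet). [cite: Tao2016AveragedNS, §4 Lemma 4.1 p. 22] -/
theorem pairing_heat_cascadeWavelet_of_ne (hε₀ : 0 < ε₀) (𝒟 : CascadeWaveletData ε₀ m) (τ : ℝ)
    {i j : Fin m} {n k : ℤ} (hne : (i, n) ≠ (j, k)) :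
    pairing (heat τ (cascadeWavelet ε₀ (𝒟.ψ i) n)) (cascadeWavelet ε₀ (𝒟.ψ j) k) = 0 :=
  pairing_cascadeWavelet_eq_zero_of_isBandLimited hε₀ 𝒟
    (heat_isBandLimited (cascadeWavelet_isBandLimited (by linarith) 𝒟 i n) τ) j k (Ne.symm hne)

/-- **Registered sub-goal `stub_synthMildHeatOrthogonal`** (closed form of
`pairing_heat_cascadeWavelet_of_ne`, the helper this file serves for `stub_synthMild`): the heat flow
keeps distinct wavelets orthogonal, `⟨e^{τΔ}ψ_{i,n}, ψ_{j,k}⟩ = 0` for `(i,n) ≠ (j,k)`. [cite: Tao2016AveragedNS, §4 Lemma 4.1 p. 22] -/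
theorem stub_synthMildHeatOrthogonal :
    ∀ {ε₀ : ℝ}, 0 < ε₀ → ∀ {m : ℕ} (𝒟 : CascadeWaveletData ε₀ m) (τ : ℝ) (i j : Fin m) (n k : ℤ),
      (i, n) ≠ (j, k) → pairing (heat τ (cascadeWavelet ε₀ (𝒟.ψ i) n)) (cascadeWavelet ε₀ (𝒟.ψ j) k) = 0 :=
  fun hε₀ _ 𝒟 τ _ _ _ _ hne => pairing_heat_cascadeWavelet_of_ne hε₀ 𝒟 τ hne

/-- **The heat kernel of a mode is real**: `⟨e^{τΔ}ψ_{i,n}, ψ_{i,n}⟩ = Re⟨e^{τΔ}ψ_{i,n}, ψ_{i,n}⟩`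
(real fields pair to real numbers, and `e^{τΔ}` preserves realness). [folklore] -/
theorem pairing_heat_cascadeWavelet_self_eq_ofReal (𝒟 : CascadeWaveletData ε₀ m) (τ : ℝ) (i : Fin m)
    (n : ℤ) :
    pairing (heat τ (cascadeWavelet ε₀ (𝒟.ψ i) n)) (cascadeWavelet ε₀ (𝒟.ψ i) n) =
      (((pairing (heat τ (cascadeWavelet ε₀ (𝒟.ψ i) n)) (cascadeWavelet ε₀ (𝒟.ψ i) n)).re : ℝ) : ℂ) :=
  eq_ofReal_re_of_im_eq_zero
    (pairing_im ((isReal_cascadeWavelet ε₀ (𝒟.ψ i) n).heat τ) (isReal_cascadeWavelet ε₀ (𝒟.ψ i) n))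

/-! ### From the chain's decay to the weighted coefficient bound -/

/-- **The weighted coefficient bound from the chain's decay**: if `Y_{j,k} = 0` for `k < n₀` and
`(1+ε₀)^{20k}|Y_{j,k}(s)| ≤ C` for all modes, then
`(1+(1+ε₀)^{10k})|Y_{j,k}(s)| ≤ C((1+ε₀)^{-20n₀} + (1+ε₀)^{-10n₀})` for all modes. [folklore] -/
theorem weighted_abs_le_of_decay (hε₀ : 0 < ε₀) {Y : Fin m → ℤ → ℝ → ℝ} {n₀ : ℤ} {C s : ℝ}
    (hlow : ∀ (i : Fin m) (n : ℤ) (t : ℝ), n < n₀ → Y i n t = 0)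
    (hdec : ∀ (i : Fin m) (n : ℤ), (1 + ε₀) ^ ((20 : ℝ) * n) * |Y i n s| ≤ C) (j : Fin m) (k : ℤ) :
    (1 + ((1 + ε₀) ^ k) ^ 10) * |Y j k s| ≤
      C * ((1 + ε₀) ^ (-(20 : ℝ) * n₀) + (1 + ε₀) ^ (-(10 : ℝ) * n₀)) := by
  set a : ℝ := 1 + ε₀ with ha
  have ha0 : 0 < a := by rw [ha]; linarith
  have ha1 : 1 ≤ a := by rw [ha]; linarith
  have hC0 : 0 ≤ C := le_trans (mul_nonneg (Real.rpow_nonneg ha0.le _) (abs_nonneg _)) (hdec j k)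
  rcases lt_or_ge k n₀ with hk | hk
  · rw [hlow j k s hk, abs_zero, mul_zero]
    positivity
  · have hk' : (n₀ : ℝ) ≤ k := by exact_mod_cast hk
    have hw : ((a ^ k) ^ 10 : ℝ) = a ^ ((10 : ℝ) * k) := by
      rw [← Real.rpow_intCast, ← Real.rpow_natCast, ← Real.rpow_mul ha0.le, mul_comm]
      norm_num
    have hY : |Y j k s| ≤ C * a ^ (-(20 : ℝ) * k) := by
      rw [show -(20 : ℝ) * k = -((20 : ℝ) * k) by ring, Real.rpow_neg ha0.le, ← div_eq_mul_inv,
        le_div_iff₀ (Real.rpow_pos_of_pos ha0 _), mul_comm]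
      exact hdec j k
    have hprod : a ^ ((10 : ℝ) * k) * a ^ (-(20 : ℝ) * k) = a ^ (-(10 : ℝ) * k) := by
      rw [← Real.rpow_add ha0]
      ring_nf
    calc (1 + (a ^ k) ^ 10) * |Y j k s| ≤ (1 + (a ^ k) ^ 10) * (C * a ^ (-(20 : ℝ) * k)) :=
          mul_le_mul_of_nonneg_left hY (by positivity)
      _ = C * (a ^ (-(20 : ℝ) * k) + a ^ (-(10 : ℝ) * k)) := by rw [hw, ← hprod]; ring
      _ ≤ C * (a ^ (-(20 : ℝ) * n₀) + a ^ (-(10 : ℝ) * n₀)) := by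
          refine mul_le_mul_of_nonneg_left (add_le_add ?_ ?_) hC0
          · exact Real.rpow_le_rpow_of_exponent_le ha1 (by linarith)
          · exact Real.rpow_le_rpow_of_exponent_le ha1 (by linarith)

/-! ### The circuit nonlinearity and the cascade operator for `0 < ε₀ ≤ 1` -/

-- adapted from `PerpetualPumpPumpTransfer.abs_quadTerm_le` (hypothesis `ε₀ < 1` relaxed to `ε₀ ≤ 1`)
/-- **Bound on the circuit nonlinearity from the weighted coefficient bound** (`0 < ε₀ ≤ 1`): if
`(1+(1+ε₀)^{10k})|X_{j,k}(s)| ≤ C` for all modes, then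
`|quadTerm_{i,n}(X(s))| ≤ K_α ((1+ε₀)^{2n}+(1+ε₀)^{3n}) (2^{10}C/(1+(1+ε₀)^{10n}))²`,
`K_α = ∑ |α|` (the shifts move the scale by at most one; `(1+ε₀)^{5(n-μ₃)/2} ≤ (1+ε₀)^{5n/2}`). [cite: Tao2016AveragedNS, §4 (4.8)] -/
theorem abs_quadTerm_le_of_le_one (hε₀ : 0 < ε₀) (hε₁ : ε₀ ≤ 1)
    (α : Fin m → Fin m → Fin m → ℤ × ℤ × ℤ → ℝ) (X : Fin m → ℤ → ℝ → ℝ) {C s : ℝ}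
    (hX : ∀ (j : Fin m) (k : ℤ), (1 + ((1 + ε₀) ^ k) ^ 10) * |X j k s| ≤ C) (i : Fin m) (n : ℤ) :
    |quadTerm ε₀ α X i n s| ≤
      (∑ i₃ : Fin m, ∑ i₁ : Fin m, ∑ i₂ : Fin m, ∑ μ ∈ TaoCascade.shiftSet, |α i₁ i₂ i₃ μ|) *
        ((((1 + ε₀) ^ n) ^ 2 + ((1 + ε₀) ^ n) ^ 3) * (2 ^ 10 * C / (1 + ((1 + ε₀) ^ n) ^ 10)) ^ 2) := by
  set a : ℝ := 1 + ε₀ with ha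
  have ha0 : 0 < a := by rw [ha]; linarith
  have ha1 : 1 ≤ a := by rw [ha]; linarith
  have ha2 : a ≤ 2 := by rw [ha]; linarith
  set c : ℝ := a ^ n with hc
  have hc0 : 0 < c := zpow_pos ha0 n
  set w : ℝ := 1 + c ^ 10 with hw
  have hw0 : 0 < w := by positivity
  have hC0 : 0 ≤ C := le_trans (by positivity) (hX i n)
  have hCw : 0 ≤ 2 ^ 10 * C / w := by positivity
  -- the coefficients at the shifted scales
  have hXb : ∀ (j : Fin m) (k : ℤ), n ≤ k + 1 → |X j k s| ≤ 2 ^ 10 * C / w := by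
    intro j k hk
    have hwk : 0 < 1 + (a ^ k) ^ 10 := by positivity
    have h1 : |X j k s| ≤ C / (1 + (a ^ k) ^ 10) := by
      rw [le_div_iff₀ hwk, mul_comm]
      exact hX j k
    refine h1.trans ?_
    rw [div_le_div_iff₀ hwk hw0]
    calc C * w ≤ C * (2 ^ 10 * (1 + (a ^ k) ^ 10)) :=
          mul_le_mul_of_nonneg_left (weight_shift_le ha1 ha2 hk) hC0
      _ = 2 ^ 10 * C * (1 + (a ^ k) ^ 10) := by ring
  -- the scale factor
  have hpow : ∀ μ₃ : ℤ, 0 ≤ μ₃ → a ^ ((5 : ℝ) * ((n : ℝ) - (μ₃ : ℝ)) / 2) ≤ c ^ 2 + c ^ 3 := by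
    intro μ₃ hμ₃
    have hμ₃' : (0 : ℝ) ≤ μ₃ := by exact_mod_cast hμ₃
    calc a ^ ((5 : ℝ) * ((n : ℝ) - (μ₃ : ℝ)) / 2) ≤ a ^ ((n : ℝ) * (5 / 2)) :=
          Real.rpow_le_rpow_of_exponent_le ha1 (by linarith)
      _ = c ^ ((5 : ℝ) / 2) := by rw [Real.rpow_mul ha0.le, Real.rpow_intCast]
      _ ≤ c ^ 2 + c ^ 3 := rpow_five_halves_le hc0
  -- shifts
  have hshift : ∀ μ ∈ TaoCascade.shiftSet,
      0 ≤ μ.2.2 ∧ n ≤ (n - μ.2.2 + μ.1) + 1 ∧ n ≤ (n - μ.2.2 + μ.2.1) + 1 := by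
    intro μ hμ
    rcases (TaoCascade.mem_shiftSet_iff μ).1 hμ with rfl | rfl | rfl | rfl <;> simp <;> omega
  -- termwise
  have hterm : ∀ (i₁ i₂ : Fin m), ∀ μ ∈ TaoCascade.shiftSet,
      |α i₁ i₂ i μ * a ^ ((5 : ℝ) * ((n : ℝ) - (μ.2.2 : ℝ)) / 2) *
          (X i₁ (n - μ.2.2 + μ.1) s * X i₂ (n - μ.2.2 + μ.2.1) s)| ≤
        |α i₁ i₂ i μ| * ((c ^ 2 + c ^ 3) * (2 ^ 10 * C / w) ^ 2) := by
    intro i₁ i₂ μ hμ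
    obtain ⟨hμ₃, hk₁, hk₂⟩ := hshift μ hμ
    rw [abs_mul, abs_mul, abs_mul, abs_of_pos (Real.rpow_pos_of_pos ha0 _)]
    have h1 := hpow μ.2.2 hμ₃
    have h2 := hXb i₁ _ hk₁
    have h3 := hXb i₂ _ hk₂
    calc |α i₁ i₂ i μ| * a ^ ((5 : ℝ) * ((n : ℝ) - (μ.2.2 : ℝ)) / 2) *
          (|X i₁ (n - μ.2.2 + μ.1) s| * |X i₂ (n - μ.2.2 + μ.2.1) s|)
        ≤ |α i₁ i₂ i μ| * (c ^ 2 + c ^ 3) * ((2 ^ 10 * C / w) * (2 ^ 10 * C / w)) :=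
          mul_le_mul (mul_le_mul_of_nonneg_left h1 (abs_nonneg _))
            (mul_le_mul h2 h3 (abs_nonneg _) hCw) (by positivity) (by positivity)
      _ = |α i₁ i₂ i μ| * ((c ^ 2 + c ^ 3) * (2 ^ 10 * C / w) ^ 2) := by ring
  have hK : 0 ≤ (c ^ 2 + c ^ 3) * (2 ^ 10 * C / w) ^ 2 := by positivity
  unfold quadTerm
  calc |∑ i₁ : Fin m, ∑ i₂ : Fin m, ∑ μ ∈ TaoCascade.shiftSet,
          α i₁ i₂ i μ * a ^ ((5 : ℝ) * ((n : ℝ) - (μ.2.2 : ℝ)) / 2) *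
            (X i₁ (n - μ.2.2 + μ.1) s * X i₂ (n - μ.2.2 + μ.2.1) s)|
      ≤ ∑ i₁ : Fin m, ∑ i₂ : Fin m, ∑ μ ∈ TaoCascade.shiftSet,
          |α i₁ i₂ i μ * a ^ ((5 : ℝ) * ((n : ℝ) - (μ.2.2 : ℝ)) / 2) *
            (X i₁ (n - μ.2.2 + μ.1) s * X i₂ (n - μ.2.2 + μ.2.1) s)| := by
        refine (Finset.abs_sum_le_sum_abs _ _).trans (Finset.sum_le_sum fun i₁ _ => ?_)
        refine (Finset.abs_sum_le_sum_abs _ _).trans (Finset.sum_le_sum fun i₂ _ => ?_)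
        exact Finset.abs_sum_le_sum_abs _ _
    _ ≤ ∑ i₁ : Fin m, ∑ i₂ : Fin m, ∑ μ ∈ TaoCascade.shiftSet,
          |α i₁ i₂ i μ| * ((c ^ 2 + c ^ 3) * (2 ^ 10 * C / w) ^ 2) :=
        Finset.sum_le_sum fun i₁ _ => Finset.sum_le_sum fun i₂ _ => Finset.sum_le_sum fun μ hμ =>
          hterm i₁ i₂ μ hμ
    _ = (∑ i₁ : Fin m, ∑ i₂ : Fin m, ∑ μ ∈ TaoCascade.shiftSet, |α i₁ i₂ i μ|) *
          ((c ^ 2 + c ^ 3) * (2 ^ 10 * C / w) ^ 2) := by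
        simp only [Finset.sum_mul]
    _ ≤ (∑ i₃ : Fin m, ∑ i₁ : Fin m, ∑ i₂ : Fin m, ∑ μ ∈ TaoCascade.shiftSet, |α i₁ i₂ i₃ μ|) *
          ((c ^ 2 + c ^ 3) * (2 ^ 10 * C / w) ^ 2) := by
        refine mul_le_mul_of_nonneg_right ?_ hK
        exact Finset.single_le_sum
          (f := fun i₃ : Fin m => ∑ i₁ : Fin m, ∑ i₂ : Fin m, ∑ μ ∈ TaoCascade.shiftSet, |α i₁ i₂ i₃ μ|)
          (fun _ _ => by positivity) (Finset.mem_univ i)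

-- adapted from `PerpetualPumpPumpTransfer.cascadeOperatorForm_eq_tsum_quadTerm` (`ε₀ < 1` relaxed to `ε₀ ≤ 1`)
/-- **The cascade operator on a field with coefficients `X_{j,k}(s)`** (`0 < ε₀ ≤ 1`): if
`⟨f, ψ_{j,k}⟩ = X_{j,k}(s)` with the weighted bound `(1+(1+ε₀)^{10k})|X_{j,k}(s)| ≤ C`, then every
scale series in `⟨C(f,f), g⟩` (4.1) is absolutely summable and
`⟨C(f,f), g⟩ = ∑_{(i,n)} quadTerm_{i,n}(X(s)) ⟨g, ψ_{i,n}⟩` (shift `n ↦ n - μ₃`, majorant `K b_n ‖g‖`). [cite: Tao2016AveragedNS, §4 (4.15)] -/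
theorem cascadeOperatorForm_eq_tsum_quadTerm_of_le_one (hε₀ : 0 < ε₀) (hε₁ : ε₀ ≤ 1)
    (𝒟 : CascadeWaveletData ε₀ m) (α : Fin m → Fin m → Fin m → ℤ × ℤ × ℤ → ℝ)
    (X : Fin m → ℤ → ℝ → ℝ) {C s : ℝ}
    (hX : ∀ (j : Fin m) (k : ℤ), (1 + ((1 + ε₀) ^ k) ^ 10) * |X j k s| ≤ C) {f : L2C}
    (hf : ∀ (j : Fin m) (k : ℤ), pairing f (cascadeWavelet ε₀ (𝒟.ψ j) k) = ((X j k s : ℝ) : ℂ))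
    (g : L2C) :
    cascadeOperatorForm ε₀ 𝒟.ψ α f f g = ∑' p : Fin m × ℤ,
      ((quadTerm ε₀ α X p.1 p.2 s : ℝ) : ℂ) * pairing g (cascadeWavelet ε₀ (𝒟.ψ p.1) p.2) := by
  have hε' : 0 < 1 + ε₀ := by linarith
  set K : ℝ := (∑ i₃ : Fin m, ∑ i₁ : Fin m, ∑ i₂ : Fin m, ∑ μ ∈ TaoCascade.shiftSet, |α i₁ i₂ i₃ μ|) *
    (2 ^ 10 * C) ^ 2 with hK
  set b : ℤ → ℝ := fun n => (((1 + ε₀) ^ n) ^ 2 + ((1 + ε₀) ^ n) ^ 3) / (1 + ((1 + ε₀) ^ n) ^ 10) ^ 2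
    with hb
  have hbsum : Summable fun p : Fin m × ℤ => b p.2 := summable_fibreBound (by linarith) m
  have habsq : ∀ (i : Fin m) (n : ℤ),
      quadTerm ε₀ (fun a b c μ => |α a b c μ|) (fun j k s => |X j k s|) i n s ≤ K * b n := by
    intro i n
    have h := abs_quadTerm_le_of_le_one hε₀ hε₁ (fun a b c μ => |α a b c μ|) (fun j k s => |X j k s|)
      (C := C) (s := s) (fun j k => by simp only [abs_abs]; exact hX j k) i n
    refine (le_abs_self _).trans (h.trans (le_of_eq ?_))
    simp only [abs_abs, hK, hb, div_pow]
    ring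
  unfold cascadeOperatorForm
  simp only [hf]
  refine (cascadeSum_eq_tsum α (fun n : ℤ => (((1 + ε₀) ^ ((5 : ℝ) * (n : ℝ) / 2) : ℝ) : ℂ))
    (fun j k => ((X j k s : ℝ) : ℂ)) (fun j k => pairing g (cascadeWavelet ε₀ (𝒟.ψ j) k)) ?_).trans ?_
  · -- every shifted piece is summable over the modes: `|term| ≤ K b_n ‖g‖`
    intro i₁ i₂ μ hμ
    refine Summable.of_norm_bounded (hbsum.mul_left (K * ‖g‖)) fun p => ?_
    have hcast : ((p.2 - μ.2.2 : ℤ) : ℝ) = (p.2 : ℝ) - (μ.2.2 : ℝ) := Int.cast_sub _ _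
    have hA : ‖(α i₁ i₂ p.1 μ : ℂ) * (((1 + ε₀) ^ ((5 : ℝ) * ((p.2 - μ.2.2 : ℤ) : ℝ) / 2) : ℝ) : ℂ) *
        (((X i₁ (p.2 - μ.2.2 + μ.1) s : ℝ) : ℂ) * ((X i₂ (p.2 - μ.2.2 + μ.2.1) s : ℝ) : ℂ))‖ ≤
          K * b p.2 := by
      rw [norm_mul, norm_mul, norm_mul, Complex.norm_real, Complex.norm_real, Complex.norm_real,
        Complex.norm_real, Real.norm_eq_abs, Real.norm_eq_abs, Real.norm_eq_abs, Real.norm_eq_abs,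
        abs_of_pos (Real.rpow_pos_of_pos hε' _), hcast]
      refine le_trans ?_ (habsq p.1 p.2)
      simp only [quadTerm]
      exact single_le_sum₃ TaoCascade.shiftSet
        (fun i₁' i₂' μ' => |α i₁' i₂' p.1 μ'| * (1 + ε₀) ^ ((5 : ℝ) * ((p.2 : ℝ) - (μ'.2.2 : ℝ)) / 2) *
          (|X i₁' (p.2 - μ'.2.2 + μ'.1) s| * |X i₂' (p.2 - μ'.2.2 + μ'.2.1) s|))
        (fun _ _ _ => by positivity) i₁ i₂ hμ
    have hG : ‖pairing g (cascadeWavelet ε₀ (𝒟.ψ p.1) p.2)‖ ≤ ‖g‖ :=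
      (norm_pairing_le _ _).trans (by rw [𝒟.norm_cascadeWavelet hε', mul_one])
    rw [norm_mul]
    calc _ ≤ K * b p.2 * ‖g‖ := mul_le_mul hA hG (norm_nonneg _) ((norm_nonneg _).trans hA)
      _ = K * ‖g‖ * b p.2 := by ring
  · refine tsum_congr fun p => ?_
    simp only [quadTerm]
    push_cast
    simp only [Finset.sum_mul]

/-! ### Exchange of the mode sum and the time integral on `[0,t]` -/

-- adapted from `PerpetualPumpPumpTransfer.hasSum_integral_duhamelTerms` (forcings continuous on `[0,t]` only)
/-- **The Duhamel terms are summable over the modes, with sum the time integral of the mode sum**: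
for forcings `Q_p` continuous on `[0,t]` with `|Q_p| ≤ B_p` there and `∑_p B_p < ∞`,
`∑_p ∫₀ᵗ Q_p(s)⟨e^{(t-s)Δ}ψ_p, w⟩ ds = ∫₀ᵗ ∑_p Q_p(s)⟨e^{(t-s)Δ}ψ_p, w⟩ ds`
(`|⟨e^{τΔ}ψ_p, w⟩| ≤ ‖w‖`). [cite: Tao2016AveragedNS, §4 Lemma 4.1 (4.14)] -/
theorem hasSum_integral_duhamelTerms_of_continuousOn (hε' : 0 < 1 + ε₀) (𝒟 : CascadeWaveletData ε₀ m)
    {Qf : Fin m × ℤ → ℝ → ℝ} {t : ℝ} (hQ : ∀ p, ContinuousOn (Qf p) (Icc 0 t)) {B : Fin m × ℤ → ℝ}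
    (hB : Summable B) (hQB : ∀ p, ∀ s ∈ Icc (0 : ℝ) t, |Qf p s| ≤ B p) (w : L2C) :
    HasSum (fun p : Fin m × ℤ => ∫ s in Ioc (0 : ℝ) t,
        ((Qf p s : ℝ) : ℂ) * pairing (heat (t - s) (cascadeWavelet ε₀ (𝒟.ψ p.1) p.2)) w)
      (∫ s in Ioc (0 : ℝ) t, ∑' p : Fin m × ℤ,
        ((Qf p s : ℝ) : ℂ) * pairing (heat (t - s) (cascadeWavelet ε₀ (𝒟.ψ p.1) p.2)) w) := by
  have hint : ∀ p : Fin m × ℤ, IntegrableOn (fun s : ℝ =>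
      ((Qf p s : ℝ) : ℂ) * pairing (heat (t - s) (cascadeWavelet ε₀ (𝒟.ψ p.1) p.2)) w) (Ioc (0 : ℝ) t) :=
    fun p => (((Complex.continuous_ofReal.comp_continuousOn (hQ p)).mul ((((continuous_heat_apply _).comp
      (continuous_const.sub continuous_id)).continuousOn.pairing_left w).mono (subset_univ _))).integrableOn_Icc
        (a := 0) (b := t)).mono_set Ioc_subset_Icc_self
  refine hasSum_integral_of_summable_integral_norm (μ := volume.restrict (Ioc (0 : ℝ) t)) hint ?_
  refine Summable.of_nonneg_of_le (fun p => integral_nonneg fun s => norm_nonneg _) (fun p => ?_)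
    ((hB.mul_right ‖w‖).mul_left (volume.real (Ioc (0 : ℝ) t)))
  calc ∫ s in Ioc (0 : ℝ) t, ‖((Qf p s : ℝ) : ℂ) * pairing (heat (t - s) (cascadeWavelet ε₀ (𝒟.ψ p.1) p.2)) w‖
      ≤ ∫ s in Ioc (0 : ℝ) t, B p * ‖w‖ := by
        refine setIntegral_mono_on (hint p).norm (integrableOn_const (measure_Ioc_lt_top.ne)) measurableSet_Ioc
          fun s hs => ?_
        rw [norm_mul, Complex.norm_real, Real.norm_eq_abs]
        refine mul_le_mul (hQB p s ⟨hs.1.le, hs.2⟩) ((norm_pairing_le _ _).trans ?_) (norm_nonneg _)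
          ((abs_nonneg _).trans (hQB p s ⟨hs.1.le, hs.2⟩))
        exact mul_le_of_le_one_left (norm_nonneg _)
          ((norm_heat_le _ _).trans_eq (𝒟.norm_cascadeWavelet hε' p.1 p.2))
    _ = volume.real (Ioc (0 : ℝ) t) * (B p * ‖w‖) := by rw [setIntegral_const, smul_eq_mul]

end Summit.NavierStokesRegularity.NavierStokesRegularity.Theorems.PerpetualPumpAveragedTypeIBlowup

end
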